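import Literature.AnabelianGeometry.SemiGraphs.ChartFibreProfiniteCompletionTransport
import Literature.AnabelianGeometry.SemiGraphs.TemperedResiduallyFiniteInjective
import Literature.AnabelianGeometry.SemiGraphs.TemperedPiChartExists
import HarnessLib

/-!
# [SemiAnbd] Prop. 3.6 (iii) as printed — at t1's vertex basepoints, and for THE constructed `π₁^temp(𝒢)`

Mochizuki, *Semi-graphs of anabelioids*, Publ. RIMS **42** (2006), Prop. 3.6 (iii) p. 38: "The full
embedding `B(G) ↪ B^temp(G)` induces an injection `π₁^temp(G) ↪ π̂₁(G)` of topological groups"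
[cite: MochizukiSemiAnbd2006, Prop 3.6(iii) p.38].  PROOF-ONLY capstone (abc-iut L3, B7e) of the B7
lineage over the unconditional chart-level injectivity `injective_chartActionFin_of_prop36`
(`TemperedResiduallyFiniteInjective.lean`, abc-iut-w4-d064, from `TemperedPiResiduallyFinite_holds`):

* `exists_injective_isProfiniteCompletion_vertex` — at t1's basepoint `ρ_v ⋙ forget` through any vertex
  `v` (`𝒢.toAnab.Pi v (forget)`), along a verticial homomorphism of Thm. 3.7 (i): the map
  `g ↦ j ι(g) j⁻¹` (`isProfiniteCompletion_conjAut_chartActionFin`) is INJECTIVE and is the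
  profinite-completion map;
* `prop36_iii_temperedPi` — the three clauses (fibre functor, profinite completion, injection) for THE
  tempered fundamental group `π₁^temp(𝒢) = 𝒢.temperedPi h36` of Prop. 3.6 (i)(ii)
  (`TemperedPiExistence.lean` / `TemperedPiChartExists.lean`, chart `𝒢.temperedPiChart h36`,
  abc-iut-L3-t9): Prop. 3.6 (i), (ii) and (iii) now hold, kernel-checked, for one and the same group.

No new definitions; nothing here takes a side on [IUTchIII] Cor. 3.12.
-/

noncomputable section

namespace Literature.AnabelianGeometry.SemiGraphs

open CategoryTheory CategoryTheory.Limits CategoryTheory.PreGaloisCategory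
open Literature.AnabelianGeometry.Anabelioids
open scoped FintypeCatDiscrete Pointwise
open _root_.Topology

universe u

namespace ProfiniteSemiGraph

variable {𝒢 : ProfiniteSemiGraph.{u}}

/-- **Prop. 3.6 (iii) as printed at t1's basepoint through a vertex**, unconditional under
`Prop36Hypotheses`: for every chart `c` and vertex `v` there are a verticial homomorphism
`ψ : Π_v → π₁^temp(𝒢)` with its defining isomorphism (Thm. 3.7 (i)) and a finiteness witness such that
`g ↦ j ι(g) j⁻¹ : π₁^temp(𝒢) → 𝒢.toAnab.Pi v (forget) = Aut (ρ_v ⋙ forget)` (`j = chartFibreFinIsoρ`) is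
INJECTIVE and is the profinite-completion map. [cite: MochizukiSemiAnbd2006, Prop 3.6(iii) p.38] -/
theorem exists_injective_isProfiniteCompletion_vertex (h36 : 𝒢.Prop36Hypotheses)
    (c : TemperedPiChart 𝒢) (v : 𝒢.graph.Vertex) :
    ∃ (ψ : 𝒢.Gv v →ₜ* c.G)
      (e : c.equiv.inverse ⋙ ObjectProperty.ι _ ⋙ restrictV 𝒢 v ≅ BTemp.res ψ)
      (hfin : ∀ X : 𝒢.toAnab.BObj,
        Finite ((chartFibre c (isTempered_of_isFinite_of_prop36 h36)).obj X)),
      Function.Injective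
          ((chartFibreFinIsoρ c (isTempered_of_isFinite_of_prop36 h36) hfin v ψ e).conjAut.toMonoidHom.comp
            (chartActionFin c (isTempered_of_isFinite_of_prop36 h36) hfin)) ∧
        IsProfiniteCompletion
          ({ toMonoidHom :=
               (chartFibreFinIsoρ c (isTempered_of_isFinite_of_prop36 h36) hfin v ψ e).conjAut.toMonoidHom.comp
                 (chartActionFin c (isTempered_of_isFinite_of_prop36 h36) hfin),
             continuous_toFun :=
               (continuous_conjAut_of_natIso
                   (chartFibreFinIsoρ c (isTempered_of_isFinite_of_prop36 h36) hfin v ψ e)).comp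
                 (continuous_chartActionFin c (isTempered_of_isFinite_of_prop36 h36) hfin) } :
            c.G →ₜ* 𝒢.toAnab.Pi v
              (ObjectProperty.ι (Action.IsContinuous (V := FintypeCat.{u}) (G := 𝒢.Gv v)) ⋙
                Action.forget FintypeCat.{u} (𝒢.Gv v))) := by
  obtain ⟨ψ, e, hfin, hPC⟩ := exists_isProfiniteCompletion_vertex h36 c v
  refine ⟨ψ, e, hfin, ?_, hPC⟩
  exact (chartFibreFinIsoρ c _ hfin v ψ e).conjAut.injective.comp
    (injective_chartActionFin_of_prop36 h36 c hfin)

/-! ### For THE tempered fundamental group `𝒢.temperedPi h36` of Prop. 3.6 (i)(ii) -/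

/-- **[SemiAnbd] Prop. 3.6 (iii) for the constructed `π₁^temp(𝒢)`** (`𝒢.temperedPi h36 =
lim_n Gal(𝒢_{∞,n}/𝒢)`, the group of Prop. 3.6 (i), charted by `𝒢.temperedPiChart h36` of Prop. 3.6 (ii),
abc-iut-L3-t9): there is a finiteness witness for which the chart basepoint `Φ` is a fibre functor of
`B(𝒢.toAnab)`, `chartActionFin : π₁^temp(𝒢) → Aut Φ = π̂₁(B(𝒢))` is the profinite-completion map
(continuous, dense image, open normal subgroups of finite index pulled back from `Aut Φ`) and it is
INJECTIVE — "the full embedding `B(G) ↪ B^temp(G)` induces an injection `π₁^temp(G) ↪ π̂₁(G)` of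
topological groups". [cite: MochizukiSemiAnbd2006, Prop 3.6(iii) p.38] -/
theorem prop36_iii_temperedPi (h36 : 𝒢.Prop36Hypotheses) :
    letI := 𝒢.toAnab.preGaloisCategory_bObj
    ∃ hfin : ∀ X : 𝒢.toAnab.BObj,
        Finite ((chartFibre (𝒢.temperedPiChart h36) (isTempered_of_isFinite_of_prop36 h36)).obj X),
      Nonempty (FiberFunctor
        (chartFibreFin (𝒢.temperedPiChart h36) (isTempered_of_isFinite_of_prop36 h36) hfin)) ∧
      IsProfiniteCompletion
        ({ toMonoidHom :=
             chartActionFin (𝒢.temperedPiChart h36) (isTempered_of_isFinite_of_prop36 h36) hfin,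
           continuous_toFun :=
             continuous_chartActionFin (𝒢.temperedPiChart h36)
               (isTempered_of_isFinite_of_prop36 h36) hfin } :
          𝒢.temperedPi h36 →ₜ*
            Aut (chartFibreFin (𝒢.temperedPiChart h36) (isTempered_of_isFinite_of_prop36 h36) hfin)) ∧
      Function.Injective
        (chartActionFin (𝒢.temperedPiChart h36) (isTempered_of_isFinite_of_prop36 h36) hfin) :=
  exists_isProfiniteCompletion_injective_chart h36 (𝒢.temperedPiChart h36)

end ProfiniteSemiGraph

end Literature.AnabelianGeometry.SemiGraphs

end
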